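import Literature.NumberTheory.EllipticCurves.GeomPointReduction
import Literature.NumberTheory.EllipticCurves.SerreOpenImageSupersingularValuationProofs
import Mathlib.AlgebraicGeometry.EllipticCurve.DivisionPolynomial.Basic
import HarnessLib

/-!
# Valuations of the `3`-torsion abscissae on a Kodaira-`III`-shaped model at `3`
# (cell `b2b-bsdres`, team n1011, seat p14 gen 2, OWNERS row T-b9 'tame tower at 3', step S1)

HONEST FRAMING (cell `b2b-bsdres`, run/shared/lean/b2b/bsd-rank1-residual/, verbatim in every
file): the goal of the cell is to DELETE the COMBINATION-SHAPED residual classes of the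
Birch–Swinnerton-Dyer formula for ALL analytic-rank `≤ 1` elliptic curves over `ℚ` — "full BSD
formula for every rank `≤ 1` curve in class `C`" assembled STRICTLY from published theorems — so
that the rank-`≤ 1` remainder becomes exactly the CONSTRUCTION-SHAPED classes, which are TYPED
(missing-input `Prop`s), NOT attempted. This is not "finishing BSD". Team n1011 (N10 / N11, the
additive block X4 ∧ `p = 3`): research route on the CONSTRUCTION-SHAPED class X4; no claim beyond the
stated classes; nothing is booked. Theorems only (no definition, no named fact).

## What this file proves (step S1 of `cells/n1011/skel/T-b9-tame-tower.md`)

Let `V` be a Weierstrass equation with integer coefficients which is **`III`-shaped at `3`**: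
`3 ∣ b₂`, `3 ∥ b₄`, `9 ∣ b₆` — the shape of a Kodaira type `III` equation at `3` once its singular
point is translated to the origin (Tate's algorithm, steps 2–4: `3 ∣ a₃, a₄, a₆`, `9 ∣ a₆`,
`27 ∤ b₈`; then `b₈ = (b₂b₆ - b₄²)/4` has `9 ∥ b₈`).  Let `v` be the valuation of the place of `ℚ̄`
over `3` (multiplicative, `v(3) < 1`) and `ψ₃ = 3X⁴ + b₂X³ + 3b₄X² + 3b₆X + b₈` the `3`-division
polynomial, whose roots in `ℚ̄` are the abscissae of the points of order `3`.  By dominant-term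
(Newton polygon) estimates:

* `valuation_le_one_of_isRoot_Ψ₃` — every root `ξ` has `v(ξ) ≤ 1`;
* `valuation_pow_four_eq_of_isRoot_Ψ₃` — **CASE B** (`9 ∣ b₂`): every root has `v(ξ)⁴ = v(3)`
  (the polygon is one segment of slope `-1/4`);
* (sequel file `TameThreeTorsionValuationCaseA.lean`) **CASE A** (`3 ∥ b₂`): every root has
  `v(ξ) = 1` or `v(ξ)³ = v(3)` (slopes `0` and `-1/3`).

These are the valuation inputs of the research note `HOME/b2b-bsdres-n1011-p14/e4/TAME-TOWER-NOTE.md`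
(numerics: the two cases are exactly the patterns {1/4} and {0, 1/3} observed on all 3 134 Kodaira-III
cells of the X4@3 r0 residue; III* is the same after `X ↦ 3X`).  Nothing here is specific to
elliptic curves over `ℚ` beyond integrality of the `bᵢ`; no torsion point, Galois group or named
fact is used.  EVIDENCE → kernel, step 1 only; the tower theorem itself is NOT claimed here.

References: Tate 1975 / Silverman *ATAEC* IV.9.4 (steps 2–4); Silverman *AEC* Ex. 3.7
(`ψ₃`); Serre 1972 §1.11 (the good-supersingular analogue, tree file
`SerreOpenImageSupersingularValuationProofs`).
-/

noncomputable section

open scoped Classical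

open Polynomial WeierstrassCurve

namespace Summit.BirchSwinnertonDyer.Rank1Residual.GaloisImage

open Literature.NumberTheory.EllipticCurves

variable (V : WeierstrassCurve ℤ)

/-- `v(3) < 1` at the place over `3`. [folklore] -/
theorem valuation_three_lt_one :
    (placeOver 3).valuation (3 : AlgebraicClosure ℚ) < 1 := by
  have h := valuation_placeOver_natCast_lt_one 3
  simpa using h

/-- `v(3) ≠ 0` at the place over `3`. [folklore] -/
theorem valuation_three_ne_zero :
    (placeOver 3).valuation (3 : AlgebraicClosure ℚ) ≠ 0 := by
  rw [Valuation.ne_zero_iff]; norm_num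

/-- `ψ₃` of an integral model, read in `ℚ̄`, evaluated. [folklore] -/
theorem eval_map_Ψ₃ (x : AlgebraicClosure ℚ) :
    (V.Ψ₃.map (Int.castRingHom (AlgebraicClosure ℚ))).eval x =
      3 * x ^ 4 + (V.b₂ : AlgebraicClosure ℚ) * x ^ 3 +
        3 * (V.b₄ : AlgebraicClosure ℚ) * x ^ 2 + 3 * (V.b₆ : AlgebraicClosure ℚ) * x +
          (V.b₈ : AlgebraicClosure ℚ) := by
  simp [WeierstrassCurve.Ψ₃]

/-- An integer divisible by `3^k` has valuation `≤ v(3)^k`. [folklore] -/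
theorem valuation_intCast_le_pow_of_dvd {n : ℤ} {k : ℕ} (h : (3 : ℤ) ^ k ∣ n) :
    (placeOver 3).valuation (n : AlgebraicClosure ℚ) ≤
      (placeOver 3).valuation (3 : AlgebraicClosure ℚ) ^ k := by
  obtain ⟨m, rfl⟩ := h
  push_cast
  rw [map_mul, map_pow]
  have hm : (placeOver 3).valuation (m : AlgebraicClosure ℚ) ≤ 1 :=
    ((placeOver 3).valuation_le_one_iff _).mpr (intCast_mem _ m)
  calc (placeOver 3).valuation (3 : AlgebraicClosure ℚ) ^ k *
        (placeOver 3).valuation (m : AlgebraicClosure ℚ)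
        ≤ (placeOver 3).valuation (3 : AlgebraicClosure ℚ) ^ k * 1 := by gcongr
    _ = _ := mul_one _

/-- An integer exactly divisible by `3` has valuation `v(3)`. [folklore] -/
theorem valuation_intCast_eq_of_dvd_of_not_dvd {n : ℤ} (h : (3 : ℤ) ∣ n)
    (h' : ¬ (9 : ℤ) ∣ n) :
    (placeOver 3).valuation (n : AlgebraicClosure ℚ) =
      (placeOver 3).valuation (3 : AlgebraicClosure ℚ) := by
  obtain ⟨m, rfl⟩ := h
  have hm : ¬ (3 : ℤ) ∣ m := by
    rintro ⟨k, rfl⟩; exact h' ⟨k, by ring⟩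
  push_cast
  rw [map_mul]
  have := valuation_placeOver_intCast_eq_one 3 (by exact_mod_cast hm)
  rw [this, mul_one]


/-! ### Generic strict-domination helpers in the value group -/

section Helpers

variable {Γ₀ : Type*} [LinearOrderedCommGroupWithZero Γ₀]

/-- Strict monotonicity of right multiplication by a nonzero element (the tree's
`mul_lt_mul_left_of_ne_zero`, `SerreOpenImageSupersingularValuationProofs`, on the other side). -/
theorem mul_lt_mul_right_of_ne_zero' {a b c : Γ₀} (hc : c ≠ 0) (h : a < b) : a * c < b * c := by
  rw [mul_comm a, mul_comm b]; exact mul_lt_mul_left_of_ne_zero hc h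

/-- `u ≤ 1 ⟹ uⁿ ≤ uᵐ` for `m ≤ n`: powers of a sub-unit decrease. -/
theorem pow_le_pow_of_le_one' {u : Γ₀} (hu : u ≤ 1) {m n : ℕ} (h : m ≤ n) :
    u ^ n ≤ u ^ m := by
  obtain ⟨k, rfl⟩ := Nat.exists_eq_add_of_le h
  rw [pow_add]
  calc u ^ m * u ^ k ≤ u ^ m * 1 := by gcongr; exact pow_le_one₀ zero_le hu
    _ = u ^ m := mul_one _

/-- The dominant-term contradiction: if `d + r = 0` then `v(r) < v(d)` is impossible. -/
theorem false_of_dominant {L : Type*} [Field L] (w : Valuation L Γ₀) {d r : L}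
    (h0 : d + r = 0) (hlt : w r < w d) : False := by
  have h1 : w (d + r) = w d := Valuation.map_add_eq_of_lt_left _ hlt
  rw [h0, map_zero] at h1
  exact (ne_of_gt (lt_of_le_of_lt zero_le hlt)) h1.symm

end Helpers

/-! ### The `III`-shape: valuations of the coefficients -/

/-- Under `3 ∣ b₂`, `3 ∣ b₄`, `9 ∣ b₆` one has `9 ∣ b₈` (`4b₈ = b₂b₆ - b₄²`). [folklore] -/
theorem nine_dvd_b₈_of_shape (hb2 : (3 : ℤ) ∣ V.b₂) (hb4 : (3 : ℤ) ∣ V.b₄) (hb6 : (9 : ℤ) ∣ V.b₆) :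
    (9 : ℤ) ∣ V.b₈ := by
  have hrel := V.b_relation
  have h9 : (9 : ℤ) ∣ 4 * V.b₈ := by
    rw [hrel]
    obtain ⟨m, hm⟩ := hb2; obtain ⟨n, hn⟩ := hb4; obtain ⟨k, hk⟩ := hb6
    exact ⟨3 * m * k - n ^ 2, by rw [hm, hn, hk]; ring⟩
  have hcop : IsCoprime (9 : ℤ) 4 := ⟨1, -2, by norm_num⟩
  exact hcop.dvd_of_dvd_mul_left h9

/-- Under `3 ∣ b₂`, `3 ∥ b₄`, `9 ∣ b₆` one has `v(b₈) = v(3)²` (`4b₈ = b₂b₆ - b₄²`, the term `b₄²`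
dominates). [folklore] -/
theorem valuation_b₈_eq_of_shape (hb2 : (3 : ℤ) ∣ V.b₂) (hb4 : (3 : ℤ) ∣ V.b₄)
    (hb4' : ¬ (9 : ℤ) ∣ V.b₄) (hb6 : (9 : ℤ) ∣ V.b₆) :
    (placeOver 3).valuation (V.b₈ : AlgebraicClosure ℚ) =
      (placeOver 3).valuation (3 : AlgebraicClosure ℚ) ^ 2 := by
  set v := (placeOver 3).valuation with hv
  set t := v (3 : AlgebraicClosure ℚ) with ht
  have ht1 : t < 1 := valuation_three_lt_one
  have ht0 : t ≠ 0 := valuation_three_ne_zero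
  have h4 : v (4 : AlgebraicClosure ℚ) = 1 := by
    have := valuation_placeOver_intCast_eq_one 3 (n := 4) (by norm_num)
    simpa using this
  have hb4v : v (V.b₄ : AlgebraicClosure ℚ) = t := valuation_intCast_eq_of_dvd_of_not_dvd hb4 hb4'
  have hb2v : v (V.b₂ : AlgebraicClosure ℚ) ≤ t := by
    simpa using valuation_intCast_le_pow_of_dvd (n := V.b₂) (k := 1) (by simpa using hb2)
  have hb6v : v (V.b₆ : AlgebraicClosure ℚ) ≤ t ^ 2 :=
    valuation_intCast_le_pow_of_dvd (n := V.b₆) (k := 2) (by norm_num; exact hb6)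
  -- `4 b₈ = -b₄² + b₂ b₆` with `v(b₂ b₆) ≤ t³ < t² = v(b₄²)`
  have hrel : (4 : AlgebraicClosure ℚ) * (V.b₈ : AlgebraicClosure ℚ) =
      -((V.b₄ : AlgebraicClosure ℚ) ^ 2) + (V.b₂ : AlgebraicClosure ℚ) * (V.b₆ : AlgebraicClosure ℚ) := by
    have := congrArg (fun z : ℤ ↦ (z : AlgebraicClosure ℚ)) V.b_relation
    push_cast at this
    rw [this]; ring
  have hdom : v ((V.b₂ : AlgebraicClosure ℚ) * (V.b₆ : AlgebraicClosure ℚ)) <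
      v (-((V.b₄ : AlgebraicClosure ℚ) ^ 2)) := by
    rw [Valuation.map_neg, map_pow, hb4v, map_mul]
    calc v (V.b₂ : AlgebraicClosure ℚ) * v (V.b₆ : AlgebraicClosure ℚ) ≤ t * t ^ 2 :=
          mul_le_mul' hb2v hb6v
      _ = t ^ 2 * t := mul_comm _ _
      _ < t ^ 2 * 1 := mul_lt_mul_left_of_ne_zero (pow_ne_zero 2 ht0) ht1
      _ = t ^ 2 := mul_one _
  have h48 : v ((4 : AlgebraicClosure ℚ) * (V.b₈ : AlgebraicClosure ℚ)) = t ^ 2 := by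
    rw [hrel, Valuation.map_add_eq_of_lt_left _ hdom, Valuation.map_neg, map_pow, hb4v]
  rwa [map_mul, h4, one_mul] at h48

/-! ### S1: valuations of the roots of `ψ₃` -/

/-- The root equation of `ψ₃`, read in `ℚ̄`. [folklore] -/
theorem eq_zero_of_isRoot_Ψ₃ (x : AlgebraicClosure ℚ)
    (hx : (V.Ψ₃.map (Int.castRingHom (AlgebraicClosure ℚ))).IsRoot x) :
    3 * x ^ 4 + (V.b₂ : AlgebraicClosure ℚ) * x ^ 3 +
        3 * (V.b₄ : AlgebraicClosure ℚ) * x ^ 2 + 3 * (V.b₆ : AlgebraicClosure ℚ) * x +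
          (V.b₈ : AlgebraicClosure ℚ) = 0 := by
  have := hx; rwa [IsRoot.def, eval_map_Ψ₃] at this

/-- **Every root of `ψ₃` is integral at `3`** on a `III`-shaped model (`3 ∣ b₂`, `3 ∣ b₄`, `9 ∣ b₆`):
for `v(ξ) > 1` the term `3ξ⁴` strictly dominates `b₂ξ³, 3b₄ξ², 3b₆ξ, b₈`. [folklore] -/
theorem valuation_le_one_of_isRoot_Ψ₃ (hb2 : (3 : ℤ) ∣ V.b₂) (hb4 : (3 : ℤ) ∣ V.b₄)
    (hb6 : (9 : ℤ) ∣ V.b₆) {x : AlgebraicClosure ℚ}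
    (hx : (V.Ψ₃.map (Int.castRingHom (AlgebraicClosure ℚ))).IsRoot x) :
    (placeOver 3).valuation x ≤ 1 := by
  set v := (placeOver 3).valuation with hv
  set t := v (3 : AlgebraicClosure ℚ) with ht
  have ht1 : t < 1 := valuation_three_lt_one
  have ht0 : t ≠ 0 := valuation_three_ne_zero
  have hb2v : v (V.b₂ : AlgebraicClosure ℚ) ≤ t := by
    simpa using valuation_intCast_le_pow_of_dvd (n := V.b₂) (k := 1) (by simpa using hb2)
  have hb4v : v (V.b₄ : AlgebraicClosure ℚ) ≤ t := by
    simpa using valuation_intCast_le_pow_of_dvd (n := V.b₄) (k := 1) (by simpa using hb4)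
  have hb6v : v (V.b₆ : AlgebraicClosure ℚ) ≤ t ^ 2 :=
    valuation_intCast_le_pow_of_dvd (n := V.b₆) (k := 2) (by norm_num; exact hb6)
  have hb8v : v (V.b₈ : AlgebraicClosure ℚ) ≤ t ^ 2 :=
    valuation_intCast_le_pow_of_dvd (n := V.b₈) (k := 2)
      (by norm_num; exact nine_dvd_b₈_of_shape V hb2 hb4 hb6)
  have heval := eq_zero_of_isRoot_Ψ₃ V x hx
  by_contra hle
  rw [not_le] at hle
  set u := v x with hu
  have hu0 : u ≠ 0 := by rintro h0; rw [h0] at hle; exact not_lt_zero hle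
  -- the four strict dominations by `v(3x⁴) = t u⁴`
  have hd : v (3 * x ^ 4) = t * u ^ 4 := by rw [map_mul, map_pow]
  have h1 : v ((V.b₂ : AlgebraicClosure ℚ) * x ^ 3) < t * u ^ 4 := by
    rw [map_mul, map_pow]
    calc v (V.b₂ : AlgebraicClosure ℚ) * u ^ 3 ≤ t * u ^ 3 := by gcongr
      _ < t * u ^ 4 := mul_lt_mul_left_of_ne_zero ht0 (pow_lt_pow_right₀ hle (by norm_num))
  have h2 : v (3 * (V.b₄ : AlgebraicClosure ℚ) * x ^ 2) < t * u ^ 4 := by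
    rw [map_mul, map_mul, map_pow]
    have hu2 : 1 < u ^ 2 := one_lt_pow₀ hle (by norm_num)
    have hu20 : u ^ 2 ≠ 0 := pow_ne_zero 2 hu0
    have key : t * u ^ 2 < u ^ 2 * u ^ 2 :=
      calc t * u ^ 2 < 1 * u ^ 2 := mul_lt_mul_right_of_ne_zero' hu20 ht1
        _ = u ^ 2 * 1 := by rw [one_mul, mul_one]
        _ < u ^ 2 * u ^ 2 := mul_lt_mul_left_of_ne_zero hu20 hu2
    calc t * v (V.b₄ : AlgebraicClosure ℚ) * u ^ 2 ≤ t * t * u ^ 2 := by gcongr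
      _ = t * (t * u ^ 2) := mul_assoc _ _ _
      _ < t * (u ^ 2 * u ^ 2) := mul_lt_mul_left_of_ne_zero ht0 key
      _ = t * u ^ 4 := by rw [← pow_add]
  have h3 : v (3 * (V.b₆ : AlgebraicClosure ℚ) * x) < t * u ^ 4 := by
    rw [map_mul, map_mul]
    have ht2 : t ^ 2 < 1 := pow_lt_one₀ zero_le ht1 (by norm_num)
    have hu3 : 1 < u ^ 3 := one_lt_pow₀ hle (by norm_num)
    have key : t ^ 2 * u < u ^ 3 * u := mul_lt_mul_right_of_ne_zero' hu0 (ht2.trans hu3)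
    calc t * v (V.b₆ : AlgebraicClosure ℚ) * u ≤ t * t ^ 2 * u := by gcongr
      _ = t * (t ^ 2 * u) := mul_assoc _ _ _
      _ < t * (u ^ 3 * u) := mul_lt_mul_left_of_ne_zero ht0 key
      _ = t * u ^ 4 := by rw [← pow_succ]
  have h4 : v (V.b₈ : AlgebraicClosure ℚ) < t * u ^ 4 := by
    have hu4 : 1 < u ^ 4 := one_lt_pow₀ hle (by norm_num)
    calc v (V.b₈ : AlgebraicClosure ℚ) ≤ t ^ 2 := hb8v
      _ = t * t := sq t
      _ < t * 1 := mul_lt_mul_left_of_ne_zero ht0 ht1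
      _ < t * u ^ 4 := mul_lt_mul_left_of_ne_zero ht0 hu4
  have hr : v ((V.b₂ : AlgebraicClosure ℚ) * x ^ 3 + 3 * (V.b₄ : AlgebraicClosure ℚ) * x ^ 2 +
      3 * (V.b₆ : AlgebraicClosure ℚ) * x + (V.b₈ : AlgebraicClosure ℚ)) < v (3 * x ^ 4) := by
    rw [hd]
    exact Valuation.map_add_lt _ (Valuation.map_add_lt _ (Valuation.map_add_lt _ h1 h2) h3) h4
  refine false_of_dominant v ?_ hr
  rw [← heval]; ring

/-- **CASE B (`9 ∣ b₂`): every root of `ψ₃` has `v(ξ)⁴ = v(3)`** — the Newton polygon of `ψ₃` is a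
single segment of slope `-1/4`: for `v(ξ)⁴ > v(3)` the term `3ξ⁴` dominates, for `v(ξ)⁴ < v(3)` the
constant term `b₈` (`v(b₈) = v(3)²`) dominates. [folklore] -/
theorem valuation_pow_four_eq_of_isRoot_Ψ₃ (hb2 : (9 : ℤ) ∣ V.b₂) (hb4 : (3 : ℤ) ∣ V.b₄)
    (hb4' : ¬ (9 : ℤ) ∣ V.b₄) (hb6 : (9 : ℤ) ∣ V.b₆) {x : AlgebraicClosure ℚ}
    (hx : (V.Ψ₃.map (Int.castRingHom (AlgebraicClosure ℚ))).IsRoot x) :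
    (placeOver 3).valuation x ^ 4 = (placeOver 3).valuation (3 : AlgebraicClosure ℚ) := by
  set v := (placeOver 3).valuation with hv
  set t := v (3 : AlgebraicClosure ℚ) with ht
  have ht1 : t < 1 := valuation_three_lt_one
  have ht0 : t ≠ 0 := valuation_three_ne_zero
  have hb2' : (3 : ℤ) ∣ V.b₂ := dvd_trans ⟨3, by norm_num⟩ hb2
  have hb2v : v (V.b₂ : AlgebraicClosure ℚ) ≤ t ^ 2 :=
    valuation_intCast_le_pow_of_dvd (n := V.b₂) (k := 2) (by norm_num; exact hb2)
  have hb4v : v (V.b₄ : AlgebraicClosure ℚ) = t := valuation_intCast_eq_of_dvd_of_not_dvd hb4 hb4'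
  have hb6v : v (V.b₆ : AlgebraicClosure ℚ) ≤ t ^ 2 :=
    valuation_intCast_le_pow_of_dvd (n := V.b₆) (k := 2) (by norm_num; exact hb6)
  have hb8v : v (V.b₈ : AlgebraicClosure ℚ) = t ^ 2 := valuation_b₈_eq_of_shape V hb2' hb4 hb4' hb6
  have heval := eq_zero_of_isRoot_Ψ₃ V x hx
  set u := v x with hu
  have hule : u ≤ 1 := valuation_le_one_of_isRoot_Ψ₃ V hb2' hb4 hb6 hx
  rcases lt_trichotomy (u ^ 4) t with hlt | heq | hgt
  · -- `b₈` dominates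
    exfalso
    have hu1 : u < 1 := by
      rcases hule.lt_or_eq with h | h
      · exact h
      · exfalso; rw [h, one_pow] at hlt; exact absurd (ht1.trans hlt) (lt_irrefl _)
    have h1 : v (3 * x ^ 4) < t ^ 2 := by
      rw [map_mul, map_pow, sq]; exact mul_lt_mul_left_of_ne_zero ht0 hlt
    have h2 : v ((V.b₂ : AlgebraicClosure ℚ) * x ^ 3) < t ^ 2 := by
      rw [map_mul, map_pow]
      calc v (V.b₂ : AlgebraicClosure ℚ) * u ^ 3 ≤ t ^ 2 * u ^ 3 := by gcongr
        _ < t ^ 2 * 1 := mul_lt_mul_left_of_ne_zero (pow_ne_zero 2 ht0) (pow_lt_one₀ zero_le hu1 (by norm_num))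
        _ = t ^ 2 := mul_one _
    have h3 : v (3 * (V.b₄ : AlgebraicClosure ℚ) * x ^ 2) < t ^ 2 := by
      rw [map_mul, map_mul, map_pow, hb4v, ← sq]
      calc t ^ 2 * u ^ 2 < t ^ 2 * 1 :=
            mul_lt_mul_left_of_ne_zero (pow_ne_zero 2 ht0) (pow_lt_one₀ zero_le hu1 (by norm_num))
        _ = t ^ 2 := mul_one _
    have h4 : v (3 * (V.b₆ : AlgebraicClosure ℚ) * x) < t ^ 2 := by
      rw [map_mul, map_mul]
      calc t * v (V.b₆ : AlgebraicClosure ℚ) * u ≤ t * t ^ 2 * 1 := by gcongr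
        _ = t ^ 2 * t := by rw [mul_one, mul_comm]
        _ < t ^ 2 * 1 := mul_lt_mul_left_of_ne_zero (pow_ne_zero 2 ht0) ht1
        _ = t ^ 2 := mul_one _
    have hr : v (3 * x ^ 4 + (V.b₂ : AlgebraicClosure ℚ) * x ^ 3 +
        3 * (V.b₄ : AlgebraicClosure ℚ) * x ^ 2 + 3 * (V.b₆ : AlgebraicClosure ℚ) * x) <
        v (V.b₈ : AlgebraicClosure ℚ) := by
      rw [hb8v]
      exact Valuation.map_add_lt _ (Valuation.map_add_lt _ (Valuation.map_add_lt _ h1 h2) h3) h4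
    refine false_of_dominant v ?_ hr
    rw [← heval]; ring
  · exact heq
  · -- `3x⁴` dominates
    exfalso
    have hu0 : u ≠ 0 := by rintro h0; rw [h0, zero_pow (by norm_num)] at hgt; exact not_lt_zero hgt
    have htu : t < u := hgt.trans_le (by simpa using pow_le_pow_of_le_one' hule (show 1 ≤ 4 by norm_num))
    have hd : v (3 * x ^ 4) = t * u ^ 4 := by rw [map_mul, map_pow]
    have h1 : v ((V.b₂ : AlgebraicClosure ℚ) * x ^ 3) < t * u ^ 4 := by
      rw [map_mul, map_pow]
      have key : t * u ^ 3 < u * u ^ 3 := mul_lt_mul_right_of_ne_zero' (pow_ne_zero 3 hu0) htu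
      calc v (V.b₂ : AlgebraicClosure ℚ) * u ^ 3 ≤ t ^ 2 * u ^ 3 := by gcongr
        _ = t * (t * u ^ 3) := by rw [sq, mul_assoc]
        _ < t * (u * u ^ 3) := mul_lt_mul_left_of_ne_zero ht0 key
        _ = t * u ^ 4 := by rw [← pow_succ']
    have h2 : v (3 * (V.b₄ : AlgebraicClosure ℚ) * x ^ 2) < t * u ^ 4 := by
      rw [map_mul, map_mul, map_pow, hb4v]
      have htu2 : t < u ^ 2 := hgt.trans_le (pow_le_pow_of_le_one' hule (show 2 ≤ 4 by norm_num))
      have key : t * u ^ 2 < u ^ 2 * u ^ 2 := mul_lt_mul_right_of_ne_zero' (pow_ne_zero 2 hu0) htu2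
      calc t * t * u ^ 2 = t * (t * u ^ 2) := mul_assoc _ _ _
        _ < t * (u ^ 2 * u ^ 2) := mul_lt_mul_left_of_ne_zero ht0 key
        _ = t * u ^ 4 := by rw [← pow_add]
    have h3 : v (3 * (V.b₆ : AlgebraicClosure ℚ) * x) < t * u ^ 4 := by
      rw [map_mul, map_mul]
      have htt : t ^ 2 < t := by
        calc t ^ 2 = t * t := sq t
          _ < t * 1 := mul_lt_mul_left_of_ne_zero ht0 ht1
          _ = t := mul_one _
      have htu3 : t ^ 2 < u ^ 3 :=
        htt.trans (hgt.trans_le (pow_le_pow_of_le_one' hule (show 3 ≤ 4 by norm_num)))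
      have key : t ^ 2 * u < u ^ 3 * u := mul_lt_mul_right_of_ne_zero' hu0 htu3
      calc t * v (V.b₆ : AlgebraicClosure ℚ) * u ≤ t * t ^ 2 * u := by gcongr
        _ = t * (t ^ 2 * u) := mul_assoc _ _ _
        _ < t * (u ^ 3 * u) := mul_lt_mul_left_of_ne_zero ht0 key
        _ = t * u ^ 4 := by rw [← pow_succ]
    have h4 : v (V.b₈ : AlgebraicClosure ℚ) < t * u ^ 4 := by
      rw [hb8v, sq]; exact mul_lt_mul_left_of_ne_zero ht0 hgt
    have hr : v ((V.b₂ : AlgebraicClosure ℚ) * x ^ 3 + 3 * (V.b₄ : AlgebraicClosure ℚ) * x ^ 2 +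
        3 * (V.b₆ : AlgebraicClosure ℚ) * x + (V.b₈ : AlgebraicClosure ℚ)) < v (3 * x ^ 4) := by
      rw [hd]
      exact Valuation.map_add_lt _ (Valuation.map_add_lt _ (Valuation.map_add_lt _ h1 h2) h3) h4
    refine false_of_dominant v ?_ hr
    rw [← heval]; ring


end Summit.BirchSwinnertonDyer.Rank1Residual.GaloisImage

end
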